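import Summits.Ventures.HodgeKum4.Theorems.KummerFixedLocusUnitSections
import Summits.Ventures.HodgeKum4.Theorems.KummerFixedLocusDihedralFixedSpace
import Literature.AlgebraicGeometry.Hyperkaehler.GeneralizedKummerFourTranslationFixedPoints
import Literature.AlgebraicGeometry.GroupActions.FixedLocusTangentDimension
import Mathlib.RepresentationTheory.Basic
import Mathlib.GroupTheory.OrderOfElement
import HarnessLib

/-!
# The atom (H3) from print: one fixed point on the Kummer fixed fourfold, by the tangent-dimension
# argument (cell `hodge-kum4`, seat p2, "Route A"; item stmt-Ventures-19595)

HONEST FRAMING.  Nothing here proves (H3) `Kum4FixedFourfoldHasFixedPointAtKummer` outright, nor the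
Hodge conjecture: the theorem is CONDITIONAL on four printed statements taken as hypotheses —
`Γ ≅ (ℤ/5)⁴` (Floccari–Varesco, REFEREED), the transitivity of `Γ(K⁴(A))` on the fixed points of each
`g ∈ Γ ∖ 1` (Oguiso 2020 Prop. 3.6 proof; print-synthesis), the shape "`125` reduced points" of those
fixed points (Oguiso 2020 Prop. 3.5–3.6, REFEREED), and the tangent-dimension form of the smoothness of
fixed-point schemes (Iversen–Fogarty–Cartan; Milne *Algebraic Groups* Thm. 13.1, Conrad–Gabber–Prasad
A.8.10, Görtz–Wedhorn Thm. 6.28; REFEREED textbook), the Literature fact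
`GroupActions.Milne2017_fixedComponent_dim_eq_finrank_tangentFixed`.  It replaces the cell's ONLY
unpublished input of rung H3 (the atom (H3), director-hodge 2026-08-26T08:09:37Z R1) by print + kernel,
WITHOUT the Hilbert-scheme point model M1–M4 (held).

## The argument (coordinate-free, datum-independent)

Let `K = K⁴(A)`, `(ι₀, W₀, i₀)` a Kummer fixed datum, `g ∈ Γ(K) ∖ 1`.
1. The `g`-fixed `ℂ`-points `S` of `K` form ONE `Γ`-orbit (H2), `Γ` is commutative of order `625`
   (FV), `S ≠ ∅` (Oguiso: `K^{⟨g⟩} = ⊔_{125} Spec ℂ`), and `ι₀` acts on `S` with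
   `ι₀(γ s) = γ⁻¹ ι₀(s)` (`ι₀ γ ι₀ = γ⁻¹`); the odd-torsor argument gives an `ι₀`-FIXED `s* ∈ S`.
2. Let `T = T_{s*}K` (the tangent representation of `Stab(s*) ∋ g, ι₀`, `dim T = 8`).  The member of
   the partition `K^{⟨g⟩}(ℂ) = ⊔ₖ {xₖ}` through `s*` is a POINT (dimension `0`), so `T^g = 0`
   (tangent-dimension fact).  By the dihedral fixed-space lemma (`Theorems/KummerFixedLocusDihedralFixedSpace`:
   `ι₀² = 1`, `ι₀ g ι₀ = g⁻¹`, `g` of odd order, `T^g = 0`) `dim T^{ι₀} = 8/2 = 4`.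
3. The datum partitions `Fix(ι₀)(ℂ) = i₀(W₀(ℂ)) ⊔ ⨆ₖ G_k(ℂ)` with `dim W₀ = 4`, `dim G_k ≤ 2`; the
   member through `s*` has dimension `dim T^{ι₀} = 4` (tangent-dimension fact), so it is `W₀`:
   `s* = i₀(p)`, and `g(i₀ p) = i₀ p`.  ∎
-/

noncomputable section

open CategoryTheory CategoryTheory.Limits MonoidalCategory CartesianMonoidalCategory
open AlgebraicGeometry
open Literature.AlgebraicGeometry Literature.AlgebraicGeometry.Motives
open Literature.AlgebraicGeometry.Hyperkaehler Literature.AlgebraicGeometry.GroupActions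

namespace Summit.Ventures.HodgeKum4

/-! ### The assembly -/

/-- **(H3) from print — one fixed point of every `g ∈ Γ ∖ 1` on the Kummer fixed fourfold of every
datum on `K⁴(A)`**, by the tangent-dimension argument (module docstring).  Inputs, all BY NAME:
`Γ ≅ (ℤ/5)⁴` (Floccari–Varesco), (H2) transitivity (Oguiso 2020 Prop. 3.6 proof), the `125` reduced
fixed points (Oguiso 2020 Prop. 3.5–3.6), and the tangent-dimension form of the smoothness of fixed
loci (Milne Thm. 13.1 / CGP A.8.10 / GW 6.28).  Kernel ingredients: the odd torsor (`exists_fixed_of_transitive`,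
`Theorems/KummerFixedLocusUnitSections`), the dihedral fixed-space lemma
(`Dihedral.two_mul_finrank_fixed_eq`), p1's `SplitPoints`. -/
theorem kum4FixedFourfoldHasFixedPointAtKummer_of_tangentFixed
    (hFV : FloccariVaresco2024_autFixingH2H3_equiv_kumType)
    (hH2 : Oguiso2020_translations_transitive_fixedPoints_generalizedKummerFour)
    (hOg : Oguiso2020_fixedPointScheme_translation_generalizedKummerFour)
    (hT : GroupActions.Milne2017_fixedComponent_dim_eq_finrank_tangentFixed) :
    Kum4FixedFourfoldHasFixedPointAtKummer := by
  intro A K hA hKum hK8 ι₀ W₀ i₀ hd g hg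
  -- `K` is of `Kum⁴`-type, separated; `Γ(K) ≅ (ℤ/5)⁴`
  obtain ⟨M⟩ := HodgeTheory.nonempty_hodgeModel_holds (n := 8) (X := K) hK8
  have hKK : IsOfGeneralizedKummerType 4 K :=
    IsOfGeneralizedKummerType.of_hodgeModel (n := 4) hA hKum hK8 M
  haveI : IsProper K.hom := hK8.isProjectiveOver.isProper
  obtain ⟨e⟩ := hFV 4 (by norm_num) hK8 hKK
  have hcomm : ∀ p q : autFixingH2H3 K, p * q = q * p := fun p q =>
    e.injective ((e.map_mul p q).trans ((mul_comm _ _).trans (e.map_mul q p).symm))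
  have hcard : Nat.card (autFixingH2H3 K) = 625 :=
    FloccariVaresco2024_autFixingH2H3_equiv_kumType.floccari2026_card hFV hK8 hKK
  haveI : Finite (autFixingH2H3 K) := Nat.finite_of_card_ne_zero (by rw [hcard]; norm_num)
  haveI : Finite (Subgroup.zpowers g.val) := by
    have hle : Subgroup.zpowers g.val ≤ autFixingH2H3 K := (Subgroup.zpowers_le).2 g.2
    exact Set.Finite.subset (Set.toFinite (autFixingH2H3 K : Set (Aut K))) hle
  -- the fixed-point scheme of `⟨g⟩`, split into `125` points (Oguiso)
  obtain ⟨F, j, hj⟩ := exists_isFixedPointScheme (Subgroup.zpowers g.val).subtype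
  obtain ⟨x, ⟨hx⟩⟩ := hOg hA hKum hK8 g hg j hj
  have hjg : j ≫ g.val.hom = j := hj.comp_hom ⟨g.val, Subgroup.mem_zpowers g.val⟩
  haveI : Mono j := hj.toIsFixedPointObject.mono
  -- involution identities
  have hιg : ι₀.hom ≫ g.val.hom ≫ ι₀.hom = g.val.inv := by
    have h' := congrArg Iso.hom (hd.conj_eq_inv g.val g.2)
    simp only [Aut.Aut_mul_def, Aut.Aut_inv_def, Iso.trans_hom, Iso.symm_hom] at h'
    exact h'
  have hι2 : ι₀.hom ≫ ι₀.hom = 𝟙 K := by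
    have h' := congrArg Iso.hom hd.mul_self
    simp only [Aut.Aut_mul_def, Iso.trans_hom] at h'
    exact h'
  -- Step 1: the `Γ`-set `S` of `g`-fixed sections with the twisted map `σ = (· ≫ ι₀)`
  let S := {y : 𝟙_ (Motives.SchemeOver ℂ) ⟶ K // y ≫ g.val.hom = y}
  have hact_mem : ∀ (γ : autFixingH2H3 K) (y : S),
      (y.val ≫ γ.val.hom) ≫ g.val.hom = y.val ≫ γ.val.hom := by
    intro γ y
    have hγg : γ.val.hom ≫ g.val.hom = g.val.hom ≫ γ.val.hom := by
      have := congrArg (fun δ : autFixingH2H3 K => δ.val.hom) (hcomm g γ)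
      simpa [Subgroup.coe_mul, Aut.Aut_mul_def] using this
    rw [Category.assoc, hγg, ← Category.assoc, y.property]
  let act : autFixingH2H3 K → S → S := fun γ y => ⟨y.val ≫ γ.val.hom, hact_mem γ y⟩
  have hσ_mem : ∀ y : S, (y.val ≫ ι₀.hom) ≫ g.val.hom = y.val ≫ ι₀.hom := by
    intro y
    have hyinv : y.val ≫ g.val.inv = y.val := by
      calc y.val ≫ g.val.inv = (y.val ≫ g.val.hom) ≫ g.val.inv := by rw [y.property]
        _ = y.val := by rw [Category.assoc, Iso.hom_inv_id, Category.comp_id]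
    have key : ι₀.hom ≫ g.val.hom = g.val.inv ≫ ι₀.hom := by
      calc ι₀.hom ≫ g.val.hom = (ι₀.hom ≫ g.val.hom ≫ ι₀.hom) ≫ ι₀.hom := by
            simp only [Category.assoc, hι2, Category.comp_id]
        _ = g.val.inv ≫ ι₀.hom := by rw [hιg]
    rw [Category.assoc, key, ← Category.assoc, hyinv]
  let σ : S → S := fun y => ⟨y.val ≫ ι₀.hom, hσ_mem y⟩
  have hσ : ∀ γ (a : S), σ (act γ a) = act γ⁻¹ (σ a) := by
    intro γ a
    have hγ : ι₀.hom ≫ γ.val.hom ≫ ι₀.hom = γ.val.inv := by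
      have h' := congrArg Iso.hom (hd.conj_eq_inv γ.val γ.2)
      simp only [Aut.Aut_mul_def, Aut.Aut_inv_def, Iso.trans_hom, Iso.symm_hom] at h'
      exact h'
    have key : γ.val.hom ≫ ι₀.hom = ι₀.hom ≫ γ.val.inv := by
      calc γ.val.hom ≫ ι₀.hom = ι₀.hom ≫ (ι₀.hom ≫ γ.val.hom ≫ ι₀.hom) := by
            rw [← Category.assoc ι₀.hom, hι2, Category.id_comp]
        _ = ι₀.hom ≫ γ.val.inv := by rw [hγ]
    have h : (a.val ≫ γ.val.hom) ≫ ι₀.hom = (a.val ≫ ι₀.hom) ≫ γ.val.inv := by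
      rw [Category.assoc, key, Category.assoc]
    exact Subtype.ext h
  have hodd : ∀ γ : autFixingH2H3 K, ∃ m : ℕ, γ ^ (2 * m + 1) = 1 :=
    fun γ => exists_pow_odd_eq_one_of_card hcard γ
  have htrans : ∀ a b : S, ∃ γ, act γ a = b := by
    intro a b
    obtain ⟨γ, hγ⟩ := hH2 hA hKum hK8 g hg a.val b.val a.property b.property
    exact ⟨γ, Subtype.ext hγ⟩
  -- a `g`-fixed section exists (one of Oguiso's `125`), hence an `ι₀`-fixed one `s*`
  let a₀ : S := ⟨x 0 ≫ j, by rw [Category.assoc, hjg]⟩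
  obtain ⟨s, hs⟩ := exists_fixed_of_transitive act
    (fun p q y => Subtype.ext
      ((Category.assoc y.val q.val.hom p.val.hom).symm :
        y.val ≫ (p * q).val.hom = (y.val ≫ q.val.hom) ≫ p.val.hom))
    hodd htrans σ hσ a₀
  have hsg : s.val ≫ g.val.hom = s.val := s.property
  have hsι : s.val ≫ ι₀.hom = s.val := congrArg Subtype.val hs
  -- Step 2: the complex point `P = s*`, its stabilizer contains `g` and `ι₀`; the tangent representation
  let P : Motives.ComplexPoints K := toUnit (Motives.specOver ℂ ℂ) ≫ s.val
  have hgP : g.val ∈ GroupActions.pointStabilizer K P := by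
    rw [GroupActions.mem_pointStabilizer_iff, Motives.AlgPoints.map_apply]
    show (toUnit (Motives.specOver ℂ ℂ) ≫ s.val) ≫ g.val.hom = toUnit (Motives.specOver ℂ ℂ) ≫ s.val
    rw [Category.assoc, hsg]
  have hιP : ι₀ ∈ GroupActions.pointStabilizer K P := by
    rw [GroupActions.mem_pointStabilizer_iff, Motives.AlgPoints.map_apply]
    show (toUnit (Motives.specOver ℂ ℂ) ≫ s.val) ≫ ι₀.hom = toUnit (Motives.specOver ℂ ℂ) ≫ s.val
    rw [Category.assoc, hsι]
  obtain ⟨V, _, _, _, τ, hVn, hτ⟩ := hT hK8 P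
  let φg : GroupActions.pointStabilizer K P := ⟨g.val, hgP⟩
  let φι : GroupActions.pointStabilizer K P := ⟨ι₀, hιP⟩
  -- orders: `g^(2m+1) = 1`, `ι₀² = 1`
  obtain ⟨m, hm⟩ := hodd g
  have hφg_pow : φg ^ (2 * m + 1) = 1 := by
    apply Subtype.ext
    rw [SubmonoidClass.coe_pow]
    show g.val ^ (2 * m + 1) = 1
    have := congrArg Subtype.val hm
    simpa using this
  have hφι_sq : φι * φι = 1 := Subtype.ext hd.mul_self
  have hφg_fin : IsOfFinOrder φg :=
    isOfFinOrder_iff_pow_eq_one.2 ⟨2 * m + 1, by omega, hφg_pow⟩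
  have hφι_fin : IsOfFinOrder φι :=
    isOfFinOrder_iff_pow_eq_one.2 ⟨2, by norm_num, by rw [pow_two, hφι_sq]⟩
  have hconjS : φι * φg * φι = φg⁻¹ := Subtype.ext (hd.conj_eq_inv g.val g.2)
  -- Step 2a: `T^g = 0` from the partition of `Fix(g)(ℂ)` into Oguiso's `125` points
  have hfixg : {y : Motives.ComplexPoints K |
        Motives.AlgPoints.mapContinuous (L := ℂ) φg.val.hom y = y} =
      ⋃ k, Set.range (Motives.AlgPoints.mapContinuous (L := ℂ) (x k ≫ j)) := by
    ext Q
    simp only [Set.mem_setOf_eq, Motives.AlgPoints.mapContinuous_apply, Motives.AlgPoints.map_apply,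
      Set.mem_iUnion, range_mapContinuous_of_unit, Set.mem_singleton_iff]
    constructor
    · intro hQ
      -- `Q` is `⟨g⟩`-fixed, hence factors through `j`, hence through one of the sections
      have hQ' : ∀ a : Subgroup.zpowers g.val,
          (Motives.toSpecOver (𝟙_ (Motives.SchemeOver ℂ)) ≫ Q) ≫
              ((Subgroup.zpowers g.val).subtype a).hom =
            Motives.toSpecOver (𝟙_ (Motives.SchemeOver ℂ)) ≫ Q := fun a => by
        show (Motives.toSpecOver (𝟙_ (Motives.SchemeOver ℂ)) ≫ Q) ≫ a.val.hom =
          Motives.toSpecOver (𝟙_ (Motives.SchemeOver ℂ)) ≫ Q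
        rw [Category.assoc, comp_hom_eq_of_mem_zpowers g.val Q hQ a.val a.property]
      obtain ⟨t, ht, -⟩ :=
        hj.existsUnique_fac (Motives.toSpecOver (𝟙_ (Motives.SchemeOver ℂ)) ≫ Q) hQ'
      obtain ⟨k, rfl⟩ := SplitPoints.exists_eq x hx t
      refine ⟨k, ?_⟩
      rw [← toUnit_comp_toSpecOver_comp Q, ← ht]
    · rintro ⟨k, rfl⟩
      show (toUnit (Motives.specOver ℂ ℂ) ≫ x k ≫ j) ≫ g.val.hom = toUnit (Motives.specOver ℂ ℂ) ≫ x k ≫ j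
      rw [Category.assoc, Category.assoc, hjg]
  have hdisjg : ∀ k k' : Fin 125, k ≠ k' →
      Disjoint (Set.range (Motives.AlgPoints.mapContinuous (L := ℂ) (x k ≫ j)))
        (Set.range (Motives.AlgPoints.mapContinuous (L := ℂ) (x k' ≫ j))) := by
    intro k k' hkk'
    rw [range_mapContinuous_of_unit, range_mapContinuous_of_unit, Set.disjoint_singleton]
    intro h
    apply hkk'
    have h1 : x k ≫ j = x k' ≫ j := toUnit_comp_injective h
    exact SplitPoints.injective x hx ((cancel_mono j).1 h1)
  obtain ⟨k₀, hk₀⟩ : ∃ k, P ∈ Set.range (Motives.AlgPoints.mapContinuous (L := ℂ) (x k ≫ j)) := by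
    have : P ∈ {y : Motives.ComplexPoints K |
        Motives.AlgPoints.mapContinuous (L := ℂ) φg.val.hom y = y} := by
      show Motives.AlgPoints.mapContinuous (L := ℂ) g.val.hom (toUnit (Motives.specOver ℂ ℂ) ≫ s.val) =
        toUnit (Motives.specOver ℂ ℂ) ≫ s.val
      rw [Motives.AlgPoints.mapContinuous_apply, Motives.AlgPoints.map_apply, Category.assoc, hsg]
    rw [hfixg, Set.mem_iUnion] at this
    exact this
  have hTg0 : 0 = Module.finrank ℂ (LinearMap.ker (τ φg - 1)) :=
    hτ φg hφg_fin (Fin 125) inferInstance (fun _ => 𝟙_ (Motives.SchemeOver ℂ)) (fun _ => 0)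
      (fun k => x k ≫ j) (fun _ => Motives.isSmoothProjective_unit_holds ℂ)
      (fun k => isClosedImmersion_left_of_unit (x k ≫ j)) hdisjg hfixg k₀ hk₀
  have hfixv : ∀ v : V, τ φg v = v → v = 0 := by
    intro v hv
    have hbot : LinearMap.ker (τ φg - 1) = ⊥ := Submodule.finrank_eq_zero.1 hTg0.symm
    have hv' : v ∈ LinearMap.ker (τ φg - 1) := by
      rw [LinearMap.mem_ker, LinearMap.sub_apply, Module.End.one_apply, hv, sub_self]
    rw [hbot] at hv'
    exact (Submodule.mem_bot ℂ).1 hv'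
  -- Step 2b: the dihedral lemma: `dim T^{ι₀} = 4`
  have hdim : Module.finrank ℂ (LinearMap.ker (τ φι - 1)) = 4 := by
    have h := Dihedral.two_mul_finrank_fixed_eq (isUnit_iff_ne_zero.2 (by norm_num : (2 : ℂ) ≠ 0))
      τ φg φι hφι_sq hconjS ⟨m, hφg_pow⟩ hfixv
    omega
  -- Step 3: the partition of `Fix(ι₀)(ℂ)` given by the datum: `W₀` and the small components `G k`
  obtain ⟨Kt, _, G, dG, iG, hGsp, hdG, hiG, hGG, hWG, hfixι⟩ := hd.2.2.2.2.2.2.2.2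
  haveI := hd.isClosedImmersion
  let Z : Option Kt → Motives.SchemeOver ℂ := fun o => o.elim W₀ G
  let d : Option Kt → ℕ := fun o => o.elim 4 dG
  let c : ∀ o, Z o ⟶ K := fun o => match o with
    | none => i₀
    | some k => iG k
  have hZsp : ∀ o, Motives.IsSmoothProjective (d o) (Z o) := fun o => by
    cases o with
    | none => exact hd.isSmoothProjective
    | some k => exact hGsp k
  have hZci : ∀ o, IsClosedImmersion (c o).left := fun o => by
    cases o with
    | none => exact hd.isClosedImmersion
    | some k => exact hiG k
  have hZdisj : ∀ o o' : Option Kt, o ≠ o' →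
      Disjoint (Set.range (Motives.AlgPoints.mapContinuous (L := ℂ) (c o)))
        (Set.range (Motives.AlgPoints.mapContinuous (L := ℂ) (c o'))) := by
    intro o o' hoo'
    cases o with
    | none =>
      cases o' with
      | none => exact absurd rfl hoo'
      | some k' => exact hWG k'
    | some k =>
      cases o' with
      | none => exact (hWG k).symm
      | some k' => exact hGG k k' (fun h => hoo' (congrArg some h))
  have hZcov : {y : Motives.ComplexPoints K |
        Motives.AlgPoints.mapContinuous (L := ℂ) φι.val.hom y = y} =
      ⋃ o, Set.range (Motives.AlgPoints.mapContinuous (L := ℂ) (c o)) := by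
    rw [Set.iUnion_option]
    exact hfixι
  -- `P` is `ι₀`-fixed, hence in some member; that member has dimension `4`, so it is `W₀`
  have hPfix : P ∈ {y : Motives.ComplexPoints K |
      Motives.AlgPoints.mapContinuous (L := ℂ) φι.val.hom y = y} := by
    show Motives.AlgPoints.mapContinuous (L := ℂ) ι₀.hom (toUnit (Motives.specOver ℂ ℂ) ≫ s.val) =
      toUnit (Motives.specOver ℂ ℂ) ≫ s.val
    rw [Motives.AlgPoints.mapContinuous_apply, Motives.AlgPoints.map_apply, Category.assoc, hsι]
  rw [hZcov, Set.mem_iUnion] at hPfix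
  obtain ⟨o₀, ho₀⟩ := hPfix
  have hdo₀ : d o₀ = 4 := by
    rw [← hdim]
    exact hτ φι hφι_fin (Option Kt) inferInstance Z d c hZsp hZci hZdisj hZcov o₀ ho₀
  cases o₀ with
  | some k =>
    -- a small component of dimension `dG k ≤ 2` cannot have dimension `4`
    exfalso
    have h4 : dG k = 4 := hdo₀
    have h2 : dG k ≤ 2 := hdG k
    omega
  | none =>
    -- `P = Q ≫ i₀` for a complex point `Q` of `W₀`
    obtain ⟨Q, hQ⟩ := ho₀
    -- `Q : Spec ℂ ⟶ W₀` (a complex point of the member `Z none = W₀`) with `Q ≫ i₀ = P`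
    have hQi : (Q ≫ i₀ : Motives.ComplexPoints K) = toUnit (Motives.specOver ℂ ℂ) ≫ s.val := hQ
    obtain ⟨p, hp⟩ : ∃ p : 𝟙_ (Motives.SchemeOver ℂ) ⟶ W₀, p ≫ i₀ = s.val :=
      ⟨Motives.toSpecOver (𝟙_ (Motives.SchemeOver ℂ)) ≫ Q,
        (Category.assoc _ _ _).trans
          ((congrArg (fun q : Motives.ComplexPoints K =>
              Motives.toSpecOver (𝟙_ (Motives.SchemeOver ℂ)) ≫ q) hQi).trans
            (toSpecOver_comp_toUnit_comp s.val))⟩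
    exact ⟨p, by rw [hp, hsg]⟩

/-! ### Corollaries: the point count and the rung, modulo print + L1 (no atom) -/

/-- **The point count `Kum4FixedPointCountAtKummer` (item stmt-Ventures-19504) from print**:
`Γ ≅ (ℤ/5)⁴`, (H2) transitivity, Oguiso's `125` reduced fixed points and the tangent-dimension fact
(composition of `kum4FixedPointCountAtKummer_of_transitive_of_hasFixedPoint` with the theorem above).
CONDITIONAL on the four printed statements; nothing is proved outright. -/
theorem kum4FixedPointCountAtKummer_of_tangentFixed
    (hFV : FloccariVaresco2024_autFixingH2H3_equiv_kumType)
    (hH2 : Oguiso2020_translations_transitive_fixedPoints_generalizedKummerFour)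
    (hOg : Oguiso2020_fixedPointScheme_translation_generalizedKummerFour)
    (hT : GroupActions.Milne2017_fixedComponent_dim_eq_finrank_tangentFixed) :
    Kum4FixedPointCountAtKummer :=
  kum4FixedPointCountAtKummer_of_transitive_of_hasFixedPoint hFV hH2
    (kum4FixedFourfoldHasFixedPointAtKummer_of_tangentFixed hFV hH2 hOg hT)

/-- **H3 for `Kum⁴`-type and its powers from PRINT + L1 ONLY** — the rung from fifteen printed
statements (the fourteen of `hc_kum4Type_of_L1_of_hasFixedPoint` and the tangent-dimension form of the
smoothness of fixed loci, Milne Thm. 13.1 / CGP A.8.10 / GW 6.28), the transitivity (H2) (printed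
synthesis) and p1's cell lemma L1; the atom (H3) is DISCHARGED by
`kum4FixedFourfoldHasFixedPointAtKummer_of_tangentFixed`.  CONDITIONAL on all of them; nothing here
says `HC_Kum4Type` or the Hodge conjecture is proved outright. -/
theorem hc_kum4Type_of_L1_of_tangentFixed
    (hOGV : OGradyVoisin2022_thirdJacobian_kugaSatake_kummerType)
    (hFF : HodgeTheory.FloccariFu2026_hodgeClasses_algebraic_powers_discOneWeilFourfold)
    (hFo : Foster2024_lefschetzStandard_kummerType_prime)
    (hAn : HodgeTheory.Andre1996_dualLefschetz_mem_adjoin_lefschetzInvolution)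
    (hA1 : HodgeTheory.Hirzebruch1969_gSignature_involution_halfDimFixedLocus)
    (hA2 : Floccari2026_fixedFourfold_kum4Type)
    (hHIR : HodgeTheory.Voisin2002_hodgeIndex_hodgeRiemann_middle)
    (hGS : GoettscheSoergel1993_chiY_kum4Type)
    (hGK : GreenKimLazaRobles2022_llvTrivial_isOfHodgeType_kumType)
    (hF : Foster2024_translationAction_kum4Type)
    (hcardF : Floccari2026_card_autFixingH2H3_kum4Type)
    (hFu : HodgeTheory.Fulton1998_cupPairing_transversalPoint)
    (hFV : FloccariVaresco2024_autFixingH2H3_equiv_kumType)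
    (hTr : HassettTschinkel2013_Floccari2026_fixedFourfoldClass_transport_kum4Type)
    (hOg : Oguiso2020_fixedPointScheme_translation_generalizedKummerFour)
    (hH2 : Oguiso2020_translations_transitive_fixedPoints_generalizedKummerFour)
    (hTan : GroupActions.Milne2017_fixedComponent_dim_eq_finrank_tangentFixed)
    (hL1 : LefschetzGenerationKum4) :
    Summit.Ventures.HodgeKum4.HC_Kum4Type ∧ Summit.Ventures.HodgeKum4.HC_Kum4TypePowers :=
  hc_kum4Type_of_L1_of_hasFixedPoint hOGV hFF hFo hAn hA1 hA2 hHIR hGS hGK hF hcardF hFu hFV hTr hOg hH2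
    hL1 (kum4FixedFourfoldHasFixedPointAtKummer_of_tangentFixed hFV hH2 hOg hTan)

end Summit.Ventures.HodgeKum4

end
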